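import Summits.QuantumFields.YangMills.Theorems.ColdStartUniversalityLatticeLangevinCouplingSynchronous
import Summits.QuantumFields.YangMills.Theorems.ColdStartUniversalityLatticeLangevinRegularFlow
import Summits.QuantumFields.YangMills.Theorems.ColdStartUniversalityLatticeLangevinLawUniqueStart
import HarnessLib

/-!
# Route `ColdStartUniversality` (fixed-cut-off SZZ dynamics):
# ★★ THE TRANSITION LAWS ARE LIPSCHITZ IN THE COUPLING CONSTANT

Helper file (seat `ym-line-csu-p1`, g33, file 65).  Consequence of the pathwise synchronous coupling in the coupling constant
(`synchronous_coupling_beta_hsDist_le`, file 64): for every observable `G` that is `L_G`-Lipschitz for the Hilbert–Schmidt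
«distance» on `SU(2)^E`, every start `x`, every lattice time `t` and ANY two strong solutions `U₁` (coupling `β₁`), `U₂`
(coupling `β₂`) from `x` on any two filtered probability spaces,

  `|E G(U₁(t)) − E G(U₂(t))| ≤ L_G · (C (β₁ − β₂)² (e^{Kt} − 1))^{1/2}`

(`abs_integral_sub_integral_le_of_couplings`: uniqueness in law `lawUnique_of_start` moves both expectations to the canonical
Wiener space, where two regular flows `exists_regularFlow` are driven by the same noise), and the same bound for every pair of
realising Markov kernel families (`abs_transition_sub_transition_le_of_couplings`): the map `β ↦ κ^β_t(x, ·)` is Lipschitz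
in the dual-Lipschitz (Wasserstein-1-type) distance, locally uniformly in `t`.  Complementary to g32's volume-free DUAL-DUHAMEL
comparison for smooth local observables (`solution_sub_solution_abs_le_coupling`, file 41: `≤ 13824π|β₁−β₂|·t·e^(λt)·Σℓ`): here every
Hilbert–Schmidt-Lipschitz observable is allowed and the coupling is pathwise, at the price of a volume-dependent constant.
THEOREMS ONLY, no sorry.  HONEST FRAMING:
fixed cut-off; `K, C` depend on `L, β₁, β₂` and the bound grows like `e^{Kt/2}` (no uniformity in the volume or in time is
claimed); no crux, rung or summit statement is proved or restated; the Yang–Mills mass gap is NOT proved.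
-/

set_option autoImplicit false

noncomputable section

namespace Summit.QuantumFields.YangMills.Theorems.ColdStartUniversality

open MeasureTheory ProbabilityTheory Finset Filter
open scoped NNReal Matrix ComplexConjugate Topology Matrix.Norms.Frobenius
open Literature.Probability.Process Literature.MathematicalPhysics.QuantumFieldTheory
open Literature.MathematicalPhysics.QuantumLattice (fundamentalRep fundamentalLatticeRep continuous_fundamentalRep
  fundamentalRep_mem_unitaryGroup)

variable {L : ℕ}

/-! ## Consequence: the transition laws depend Lipschitz-continuously on the coupling -/

/-- ★★ **The SZZ transition laws are Lipschitz in the coupling constant (every-solution form).**  There are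
`K = K(L, β₁) > 0`, `C = C(L, β₁, β₂) ≥ 0` such that for every observable `G` which is `L_G`-Lipschitz for the Hilbert–Schmidt
«distance» (`|G u − G v| ≤ L_G (Σ_e ‖ρu_e − ρv_e‖_F²)^{1/2}`), every start `x`, every lattice time `t` and ANY two strong
solutions `U₁` (coupling `β₁`) and `U₂` (coupling `β₂`) from `x` on ANY two filtered probability spaces:
`|E G(U₁(t)) − E G(U₂(t))| ≤ L_G · (C (β₁ − β₂)² (e^{Kt} − 1))^{1/2}` (uniqueness in law + the pathwise synchronous coupling
of two regular flows on the canonical space). [folklore] -/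
theorem abs_integral_sub_integral_le_of_couplings (L : ℕ) [NeZero L] (β₁ β₂ : ℝ) :
    ∃ K C : ℝ, 0 < K ∧ 0 ≤ C ∧
      ∀ (G : GaugeConfig 3 L (Matrix.specialUnitaryGroup (Fin 2) ℂ) → ℝ) (LG : ℝ), 0 ≤ LG →
        (∀ u v, |G u - G v| ≤ LG * Real.sqrt (∑ e, hsForm (fundamentalLatticeRep 2).N
          ((fundamentalLatticeRep 2).ρ (u e) - (fundamentalLatticeRep 2).ρ (v e))
          ((fundamentalLatticeRep 2).ρ (u e) - (fundamentalLatticeRep 2).ρ (v e)))) →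
        ∀ (x : GaugeConfig 3 L (Matrix.specialUnitaryGroup (Fin 2) ℂ)) (t : ℝ≥0)
          (Ω₁ : Type) [MeasurableSpace Ω₁] (P₁ : Measure Ω₁) [IsProbabilityMeasure P₁]
          (W₁ : ℝ≥0 → Ω₁ → (Edge 3 L × NoiseIdx 2 → ℝ)) (hW₁ : IsFlatBrownian W₁ P₁)
          (U₁ : ℝ≥0 → Ω₁ → GaugeConfig 3 L (Matrix.specialUnitaryGroup (Fin 2) ℂ)),
          (∀ ω, U₁ 0 ω = x) →
          (latticeLangevinDynamics (fundamentalLatticeRep 2) β₁).IsSolution (fundamentalRep (Fin 2))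
            hW₁.natFiltration P₁ W₁ U₁ →
        ∀ (Ω₂ : Type) [MeasurableSpace Ω₂] (P₂ : Measure Ω₂) [IsProbabilityMeasure P₂]
          (W₂ : ℝ≥0 → Ω₂ → (Edge 3 L × NoiseIdx 2 → ℝ)) (hW₂ : IsFlatBrownian W₂ P₂)
          (U₂ : ℝ≥0 → Ω₂ → GaugeConfig 3 L (Matrix.specialUnitaryGroup (Fin 2) ℂ)),
          (∀ ω, U₂ 0 ω = x) →
          (latticeLangevinDynamics (fundamentalLatticeRep 2) β₂).IsSolution (fundamentalRep (Fin 2))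
            hW₂.natFiltration P₂ W₂ U₂ →
          |(∫ ω, G (U₁ t ω) ∂P₁) - ∫ ω, G (U₂ t ω) ∂P₂| ≤
            LG * Real.sqrt (C * (β₁ - β₂) ^ 2 * (Real.exp (K * t) - 1)) := by
  classical
  haveI := secondCountableTopology_su2
  haveI := borelSpace_config L
  haveI : Nonempty (GaugeConfig 3 L (Matrix.specialUnitaryGroup (Fin 2) ℂ)) := ⟨fun _ => 1⟩
  set β : Bool → ℝ := fun s => bif s then β₁ else β₂ with hβ
  obtain ⟨K, C, hK, hC, hmain⟩ := synchronous_coupling_beta_hsDist_le L β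
  refine ⟨K, C, hK, hC, fun G LG hLG hLip x t Ω₁ _ P₁ _ W₁ hW₁ U₁ hU₁0 hU₁ Ω₂ _ P₂ _ W₂ hW₂ U₂ hU₂0 hU₂ => ?_⟩
  set r2 := fundamentalLatticeRep 2 with hr2
  -- `G` is continuous, hence measurable and bounded
  have hGc : Continuous G := by
    have hD : ∀ u : GaugeConfig 3 L (Matrix.specialUnitaryGroup (Fin 2) ℂ), Continuous
        fun v : GaugeConfig 3 L (Matrix.specialUnitaryGroup (Fin 2) ℂ) =>
          LG * Real.sqrt (∑ e, hsForm r2.N (r2.ρ (v e) - r2.ρ (u e)) (r2.ρ (v e) - r2.ρ (u e))) := by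
      intro u
      refine continuous_const.mul (Real.continuous_sqrt.comp (continuous_finsetSum _ fun e _ => ?_))
      have hM : Continuous fun v : GaugeConfig 3 L (Matrix.specialUnitaryGroup (Fin 2) ℂ) => r2.ρ (v e) - r2.ρ (u e) :=
        (r2.continuous.comp (continuous_apply e)).sub continuous_const
      simp only [hsForm_apply]
      exact Complex.continuous_re.comp ((hM.matrix_mul hM.matrix_conjTranspose).matrix_trace)
    refine continuous_iff_continuousAt.2 fun u => Metric.tendsto_nhds.2 fun ε hε => ?_
    have h0 : LG * Real.sqrt (∑ e, hsForm r2.N (r2.ρ (u e) - r2.ρ (u e)) (r2.ρ (u e) - r2.ρ (u e))) = 0 := by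
      simp only [sub_self, map_zero, sum_const_zero, Real.sqrt_zero, mul_zero]
    have ht := (hD u).tendsto u
    rw [h0] at ht
    filter_upwards [ht.eventually (gt_mem_nhds hε)] with v hv
    rw [Real.dist_eq]
    exact (hLip v u).trans_lt hv
  have hGm : Measurable G := hGc.measurable
  obtain ⟨M, hM⟩ : ∃ M : ℝ, ∀ z, |G z| ≤ M := by
    obtain ⟨z₀, -, hz₀⟩ := isCompact_univ.exists_isMaxOn Set.univ_nonempty (continuous_abs.comp hGc).continuousOn
    exact ⟨|G z₀|, fun z => isMaxOn_iff.1 hz₀ z (Set.mem_univ z)⟩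
  -- the canonical space and the two regular flows driven by the same noise
  haveI := isProbabilityMeasure_piWiener (Edge 3 L × NoiseIdx 2)
  have hWpi := isFlatBrownian_piWiener 3 L (NoiseIdx 2)
  obtain ⟨V₁, -, hV₁, hV₁m, -, -, -⟩ := exists_regularFlow L β₁ hWpi
  obtain ⟨V₂, -, hV₂, hV₂m, -, -, -⟩ := exists_regularFlow L β₂ hWpi
  set V : Bool → GaugeConfig 3 L (Matrix.specialUnitaryGroup (Fin 2) ℂ) → ℝ≥0 →
      ((Edge 3 L × NoiseIdx 2) → (ℝ≥0 → ℝ)) → GaugeConfig 3 L (Matrix.specialUnitaryGroup (Fin 2) ℂ) :=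
    fun s => bif s then V₁ else V₂ with hV
  have hVsol : ∀ s y, (∀ ω, V s y 0 ω = y) ∧
      (latticeLangevinDynamics (fundamentalLatticeRep 2) (β s)).IsSolution (fundamentalRep (Fin 2)) hWpi.natFiltration
        (Measure.pi fun _ : Edge 3 L × NoiseIdx 2 => preWienerMeasure)
        (fun (t : ℝ≥0) (ω : (Edge 3 L × NoiseIdx 2) → (ℝ≥0 → ℝ)) (i : Edge 3 L × NoiseIdx 2) => brownian t (ω i))
        (V s y) := by
    intro s y; cases s
    · exact hV₂ y
    · exact hV₁ y
  have hVm : ∀ (s : Bool) (i : ℝ≥0), Measurable[@Prod.instMeasurableSpace (Set.Iic i)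
      (GaugeConfig 3 L (Matrix.specialUnitaryGroup (Fin 2) ℂ) × ((Edge 3 L × NoiseIdx 2) → (ℝ≥0 → ℝ))) inferInstance
      (@Prod.instMeasurableSpace (GaugeConfig 3 L (Matrix.specialUnitaryGroup (Fin 2) ℂ))
        ((Edge 3 L × NoiseIdx 2) → (ℝ≥0 → ℝ)) inferInstance (hWpi.natFiltration i))]
      (fun q : Set.Iic i × (GaugeConfig 3 L (Matrix.specialUnitaryGroup (Fin 2) ℂ) ×
        ((Edge 3 L × NoiseIdx 2) → (ℝ≥0 → ℝ))) => V s q.2.1 q.1 q.2.2) := by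
    intro s i; cases s
    · exact hV₂m i
    · exact hV₁m i
  have hae := hmain hWpi V hVsol hVm x
  -- uniqueness in law: both expectations are canonical-space expectations
  have hmV : ∀ (s : Bool) (u : ℝ≥0), Measurable (V s x u) := fun s u =>
    ((hVsol s x).2.adapted u).mono (hWpi.natFiltration.le u) le_rfl
  have hmU₁ : Measurable (U₁ t) := (hU₁.adapted t).mono (hW₁.natFiltration.le t) le_rfl
  have hmU₂ : Measurable (U₂ t) := (hU₂.adapted t).mono (hW₂.natFiltration.le t) le_rfl
  have hlaw₁ : P₁.map (U₁ t) = (Measure.pi fun _ : Edge 3 L × NoiseIdx 2 => preWienerMeasure).map (V true x t) :=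
    lawUnique_of_start β₁ x hW₁ hWpi hU₁0 hU₁ (hVsol true x).1 (hVsol true x).2 t
  have hlaw₂ : P₂.map (U₂ t) = (Measure.pi fun _ : Edge 3 L × NoiseIdx 2 => preWienerMeasure).map (V false x t) :=
    lawUnique_of_start β₂ x hW₂ hWpi hU₂0 hU₂ (hVsol false x).1 (hVsol false x).2 t
  have hI₁ : ∫ ω, G (U₁ t ω) ∂P₁ = ∫ ω, G (V true x t ω) ∂(Measure.pi fun _ : Edge 3 L × NoiseIdx 2 => preWienerMeasure) := by
    rw [← integral_map hmU₁.aemeasurable hGm.aestronglyMeasurable, hlaw₁,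
      integral_map (hmV true t).aemeasurable hGm.aestronglyMeasurable]
  have hI₂ : ∫ ω, G (U₂ t ω) ∂P₂ = ∫ ω, G (V false x t ω) ∂(Measure.pi fun _ : Edge 3 L × NoiseIdx 2 => preWienerMeasure) := by
    rw [← integral_map hmU₂.aemeasurable hGm.aestronglyMeasurable, hlaw₂,
      integral_map (hmV false t).aemeasurable hGm.aestronglyMeasurable]
  rw [hI₁, hI₂]
  -- integrability of the bounded observables along the flows
  have hint : ∀ s : Bool, Integrable (fun ω => G (V s x t ω)) (Measure.pi fun _ : Edge 3 L × NoiseIdx 2 => preWienerMeasure) :=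
    fun s => (integrable_const M).mono' (hGm.comp (hmV s t)).aestronglyMeasurable
      (Eventually.of_forall fun ω => by rw [Real.norm_eq_abs]; exact hM _)
  rw [← integral_sub (hint true) (hint false)]
  refine (abs_integral_le_integral_abs).trans ?_
  have hmono : ∫ ω, |G (V true x t ω) - G (V false x t ω)| ∂(Measure.pi fun _ : Edge 3 L × NoiseIdx 2 => preWienerMeasure) ≤
      ∫ _ω, LG * Real.sqrt (C * (β₁ - β₂) ^ 2 * (Real.exp (K * t) - 1))
        ∂(Measure.pi fun _ : Edge 3 L × NoiseIdx 2 => preWienerMeasure) := by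
    refine integral_mono_ae ((hint true).sub (hint false)).abs (integrable_const _) ?_
    filter_upwards [hae] with ω hω
    refine (hLip _ _).trans (mul_le_mul_of_nonneg_left (Real.sqrt_le_sqrt ?_) hLG)
    have h := hω t
    exact h
  refine hmono.trans (le_of_eq ?_)
  rw [integral_const, smul_eq_mul, probReal_univ, one_mul]

/-- ★★ **The SZZ transition kernels are Lipschitz in the coupling constant.**  For realising Markov kernel families
`κ₁` (coupling `β₁`) and `κ₂` (coupling `β₂`) — `κᵢ t x` = the law at time `t` of every strong solution from `x` — every
`hsDist`-Lipschitz observable `G`, start `x` and time `t`: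
`|∫ G dκ₁_t(x) − ∫ G dκ₂_t(x)| ≤ L_G (C (β₁ − β₂)² (e^{Kt} − 1))^{1/2}`. [folklore] -/
theorem abs_transition_sub_transition_le_of_couplings (L : ℕ) [NeZero L] (β₁ β₂ : ℝ) :
    ∃ K C : ℝ, 0 < K ∧ 0 ≤ C ∧
      ∀ (κ₁ κ₂ : ℝ≥0 → Kernel (GaugeConfig 3 L (Matrix.specialUnitaryGroup (Fin 2) ℂ))
          (GaugeConfig 3 L (Matrix.specialUnitaryGroup (Fin 2) ℂ))),
        (∀ (t : ℝ≥0) (x : GaugeConfig 3 L (Matrix.specialUnitaryGroup (Fin 2) ℂ))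
          (Ω : Type) [MeasurableSpace Ω] (P : Measure Ω) [IsProbabilityMeasure P]
          (W : ℝ≥0 → Ω → (Edge 3 L × NoiseIdx 2 → ℝ)) (hW : IsFlatBrownian W P)
          (U : ℝ≥0 → Ω → GaugeConfig 3 L (Matrix.specialUnitaryGroup (Fin 2) ℂ)),
          (∀ ω, U 0 ω = x) →
          (latticeLangevinDynamics (fundamentalLatticeRep 2) β₁).IsSolution (fundamentalRep (Fin 2))
            hW.natFiltration P W U →
          κ₁ t x = P.map (U t)) →
        (∀ (t : ℝ≥0) (x : GaugeConfig 3 L (Matrix.specialUnitaryGroup (Fin 2) ℂ))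
          (Ω : Type) [MeasurableSpace Ω] (P : Measure Ω) [IsProbabilityMeasure P]
          (W : ℝ≥0 → Ω → (Edge 3 L × NoiseIdx 2 → ℝ)) (hW : IsFlatBrownian W P)
          (U : ℝ≥0 → Ω → GaugeConfig 3 L (Matrix.specialUnitaryGroup (Fin 2) ℂ)),
          (∀ ω, U 0 ω = x) →
          (latticeLangevinDynamics (fundamentalLatticeRep 2) β₂).IsSolution (fundamentalRep (Fin 2))
            hW.natFiltration P W U →
          κ₂ t x = P.map (U t)) →
        ∀ (G : GaugeConfig 3 L (Matrix.specialUnitaryGroup (Fin 2) ℂ) → ℝ) (LG : ℝ), 0 ≤ LG →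
          (∀ u v, |G u - G v| ≤ LG * Real.sqrt (∑ e, hsForm (fundamentalLatticeRep 2).N
            ((fundamentalLatticeRep 2).ρ (u e) - (fundamentalLatticeRep 2).ρ (v e))
            ((fundamentalLatticeRep 2).ρ (u e) - (fundamentalLatticeRep 2).ρ (v e)))) →
          Measurable G →
        ∀ (x : GaugeConfig 3 L (Matrix.specialUnitaryGroup (Fin 2) ℂ)) (t : ℝ≥0),
          |(∫ z, G z ∂(κ₁ t x)) - ∫ z, G z ∂(κ₂ t x)| ≤ LG * Real.sqrt (C * (β₁ - β₂) ^ 2 * (Real.exp (K * t) - 1)) := by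
  obtain ⟨K, C, hK, hC, h⟩ := abs_integral_sub_integral_le_of_couplings L β₁ β₂
  refine ⟨K, C, hK, hC, fun κ₁ κ₂ hreal₁ hreal₂ G LG hLG hLip hGm x t => ?_⟩
  haveI := isProbabilityMeasure_piWiener (Edge 3 L × NoiseIdx 2)
  have hWpi := isFlatBrownian_piWiener 3 L (NoiseIdx 2)
  obtain ⟨U₁, hU₁0, hU₁⟩ := solution_from_start hWpi β₁ x
  obtain ⟨U₂, hU₂0, hU₂⟩ := solution_from_start hWpi β₂ x
  have hm₁ : Measurable (U₁ t) := (hU₁.adapted t).mono (hWpi.natFiltration.le t) le_rfl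
  have hm₂ : Measurable (U₂ t) := (hU₂.adapted t).mono (hWpi.natFiltration.le t) le_rfl
  rw [hreal₁ t x _ (Measure.pi fun _ : Edge 3 L × NoiseIdx 2 => preWienerMeasure) _ hWpi U₁ hU₁0 hU₁,
    hreal₂ t x _ (Measure.pi fun _ : Edge 3 L × NoiseIdx 2 => preWienerMeasure) _ hWpi U₂ hU₂0 hU₂,
    integral_map hm₁.aemeasurable hGm.aestronglyMeasurable, integral_map hm₂.aemeasurable hGm.aestronglyMeasurable]
  exact h G LG hLG hLip x t _ (Measure.pi fun _ : Edge 3 L × NoiseIdx 2 => preWienerMeasure) _ hWpi U₁ hU₁0 hU₁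
    _ (Measure.pi fun _ : Edge 3 L × NoiseIdx 2 => preWienerMeasure) _ hWpi U₂ hU₂0 hU₂

end Summit.QuantumFields.YangMills.Theorems.ColdStartUniversality

end
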